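import Mathlib.Topology.Sheaves.SheafCondition.Sites
import Mathlib.CategoryTheory.Sites.CoverLifting
import Mathlib.CategoryTheory.Sites.Pullback
import Mathlib.CategoryTheory.Sites.ConstantSheaf
import Mathlib.CategoryTheory.Sites.Limits
import Mathlib.CategoryTheory.Sites.Abelian
import Mathlib.Algebra.Category.Grp.AB
import Mathlib.Algebra.Category.Grp.Limits
import Mathlib.Algebra.Category.Grp.FilteredColimits
import Mathlib.CategoryTheory.Limits.Preserves.Finite
import Mathlib.CategoryTheory.Preadditive.LeftExact
import HarnessLib

/-!
# Restriction of sheaves along an open embedding is exact and preserves constant sheaves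

Let `f : Y ⟶ X` be an open embedding of topological spaces (`IsOpenEmbedding f`; e.g. the
inclusion of an open subset, or the underlying map of an open immersion of schemes). The
restriction `F ↦ F|_Y`, `F|_Y(V) = F(f(V))`, of sheaves on `X` to sheaves on `Y` is precomposition
with the functor `V ↦ f(V)`, `Opens Y ⥤ Opens X` (Mathlib `IsOpenMap.functor`), which Mathlib knows
to be continuous (`IsOpenEmbedding.functor_isContinuous`; for `Y = U ⊆ X` the resulting functor is
Mathlib's `TopologicalSpace.Opens.sheafRestrict`). This file adds:

* `isCocontinuous_functor` — `V ↦ f(V)` is also COCONTINUOUS (cover-lifting);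
* `restrict hf A : Sheaf X A ⥤ Sheaf Y A` (`restrict_obj_obj`: sections by `rfl`);
* for abelian sheaves (`A = AddCommGrpCat`): `restrict` is both a left adjoint
  (`isLeftAdjoint_restrict`, of `f_*`) and a right adjoint (`isRightAdjoint_restrict`, of `f_!`),
  hence **exact** (`preservesFiniteLimits_restrict`, `preservesFiniteColimits_restrict`) and
  additive (`additive_restrict`) — the hypotheses of `HyperExt.mapExactFunctor`
  (`Literature/Algebra/Homology/HyperExtExactFunctor.lean`);
* `restrictConstantSheafIso` — **`A_X|_Y ≅ A_Y`** for constant sheaves, naturally in `A`.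

## Why

These are the sheaf-theoretic inputs of the restriction maps `ℍⁿ(X, K) → ℍⁿ(Y, K|_Y)` on
hypercohomology `ℍⁿ = Hom_{D(Sh)}(ℤ, K⟦n⟧)` (`Crystalline/SheafHypercohomology`) and of their
compatibility with the connecting maps of the stupid filtration (restriction of the Hodge-to-de Rham
differentials to the generic fibre, around `Crystalline.HodgeDeRhamDegeneratesModTorsion`).

## References

* The Stacks project, Tag 00XI (Sites, §7.20 Cocontinuous functors), Tag 00XZ (Sites, §7.25
  Localization: the restriction `j_U⁻¹` and its adjoints `j_{U!}`, `j_{U*}`), Tag 03DH (Modules on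
  sites, §18.19: the same for sheaves of modules; exactness of `j_U^*`). [StacksProject]
* M. Artin, A. Grothendieck, J.-L. Verdier, SGA 4, Exp. III 2.1–2.3, Exp. IV 8 (localisation).
* R. Hartshorne, *Algebraic Geometry*, II Ex. 1.19 (restriction and extension by zero). [folklore]
-/

open CategoryTheory TopologicalSpace Topology Opposite Limits

universe v u w

namespace Literature.Topology

variable {X Y : TopCat.{u}} {f : Y ⟶ X} (hf : IsOpenEmbedding f)

/-- The functor `V ↦ f(V)`, `Opens Y ⥤ Opens X`, of an open embedding `f : Y ⟶ X` is
**cocontinuous** (cover-lifting, SGA 4 III 2.1): a covering of `f(V)` in `X` pulls back along `f` to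
a covering of `V` in `Y` (`W ↦ V ∩ f⁻¹W`). Mathlib has its continuity
(`IsOpenEmbedding.functor_isContinuous`). [cite: StacksProject, Tag 00XI] -/
theorem isCocontinuous_functor :
    hf.isOpenMap.functor.IsCocontinuous (Opens.grothendieckTopology Y)
      (Opens.grothendieckTopology X) := by
  constructor
  intro V S hS
  rw [Opens.mem_grothendieckTopology]
  intro y hy
  obtain ⟨W, i, hi, hW⟩ := hS (f y) ⟨y, hy, rfl⟩
  refine ⟨V ⊓ (Opens.map f).obj W, homOfLE inf_le_left, ?_, hy, hW⟩
  change S (hf.isOpenMap.functor.map (homOfLE inf_le_left))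
  have hle : hf.isOpenMap.functor.obj (V ⊓ (Opens.map f).obj W) ≤ W := by
    rintro _ ⟨z, ⟨-, hz⟩, rfl⟩
    exact hz
  have : hf.isOpenMap.functor.map (homOfLE (inf_le_left : V ⊓ (Opens.map f).obj W ≤ V)) =
      homOfLE hle ≫ i := Subsingleton.elim _ _
  rw [this]
  exact S.downward_closed hi _

variable (A : Type w) [Category.{v} A]

/-- **Restriction of `A`-valued sheaves along an open embedding `f : Y ⟶ X`** (`F ↦ F|_Y`,
`F|_Y(V) = F(f(V))`): precomposition with the (continuous) functor `V ↦ f(V)`, `Opens Y ⥤ Opens X`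
(Mathlib `Functor.sheafPushforwardContinuous`; for `Y = U ⊆ X` this is Mathlib's
`TopologicalSpace.Opens.sheafRestrict`). [cite: StacksProject, Tag 00XZ] -/
noncomputable def restrict : Sheaf (Opens.grothendieckTopology X) A ⥤
    Sheaf (Opens.grothendieckTopology Y) A :=
  haveI := hf.functor_isContinuous
  hf.isOpenMap.functor.sheafPushforwardContinuous A _ _

/-- Sections of the restriction: `F|_Y(V) = F(f(V))` (by `rfl`). [folklore] -/
theorem restrict_obj_obj (F : Sheaf (Opens.grothendieckTopology X) A) (V : Opens Y) :
    ((restrict hf A).obj F).obj.obj (op V) = F.obj.obj (op (hf.isOpenMap.functor.obj V)) :=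
  rfl

section Ab

/-- Restriction of abelian sheaves along an open embedding is a LEFT adjoint (of the functor
`f_* : Sh(Y) ⥤ Sh(X)` in its `sheafPushforwardCocontinuous` form, Mathlib
`Functor.sheafAdjunctionCocontinuous`, the functor `V ↦ f(V)` being continuous and cocontinuous),
hence preserves all colimits. [cite: StacksProject, Tag 00XZ] -/
theorem isLeftAdjoint_restrict : (restrict hf AddCommGrpCat.{u}).IsLeftAdjoint := by
  haveI := isCocontinuous_functor hf
  haveI := hf.functor_isContinuous
  exact ⟨_, ⟨hf.isOpenMap.functor.sheafAdjunctionCocontinuous AddCommGrpCat.{u}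
    (Opens.grothendieckTopology Y) (Opens.grothendieckTopology X)⟩⟩

/-- Restriction of abelian sheaves along an open embedding is a RIGHT adjoint (of extension by
zero `f_!`, here in the form of Mathlib's
`Functor.sheafPullbackConstruction.sheafAdjunctionContinuous`: left Kan extension followed by
sheafification), hence preserves all limits. [cite: StacksProject, Tag 00XZ] -/
theorem isRightAdjoint_restrict : (restrict hf AddCommGrpCat.{u}).IsRightAdjoint := by
  haveI := hf.functor_isContinuous
  exact ⟨_, ⟨Functor.sheafPullbackConstruction.sheafAdjunctionContinuous hf.isOpenMap.functor
    AddCommGrpCat.{u} (Opens.grothendieckTopology Y) (Opens.grothendieckTopology X)⟩⟩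

/-- **Restriction of abelian sheaves to an open subspace is exact**, limit half: it preserves finite
limits. Stated as a theorem; use `haveI`. [cite: StacksProject, Tag 00XZ] -/
theorem preservesFiniteLimits_restrict :
    PreservesFiniteLimits (restrict hf AddCommGrpCat.{u}) := by
  haveI := isRightAdjoint_restrict hf
  infer_instance

/-- **Restriction of abelian sheaves to an open subspace is exact**, colimit half: it preserves
finite colimits. Stated as a theorem; use `haveI`. [cite: StacksProject, Tag 00XZ] -/
theorem preservesFiniteColimits_restrict :
    PreservesFiniteColimits (restrict hf AddCommGrpCat.{u}) := by
  haveI := isLeftAdjoint_restrict hf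
  infer_instance

/-- Restriction of abelian sheaves along an open embedding is an additive functor. [folklore] -/
theorem additive_restrict : (restrict hf AddCommGrpCat.{u}).Additive := by
  haveI := preservesFiniteLimits_restrict hf
  exact Functor.additive_of_preserves_binary_products _

/-- **The restriction of a constant sheaf is the constant sheaf**: `A_X|_Y ≅ A_Y` naturally in the
abelian group `A` (restriction along a continuous and cocontinuous functor commutes with
sheafification, Mathlib `Functor.pushforwardContinuousSheafificationCompatibility`, and the
restriction of a constant presheaf is the constant presheaf, by `rfl`). [folklore] -/
noncomputable def restrictConstantSheafIso :
    constantSheaf (Opens.grothendieckTopology X) AddCommGrpCat.{u} ⋙ restrict hf AddCommGrpCat.{u} ≅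
      constantSheaf (Opens.grothendieckTopology Y) AddCommGrpCat.{u} :=
  haveI := isCocontinuous_functor hf
  haveI := hf.functor_isContinuous
  (Functor.isoWhiskerLeft (Functor.const (Opens X)ᵒᵖ)
    (hf.isOpenMap.functor.pushforwardContinuousSheafificationCompatibility AddCommGrpCat.{u}
      (Opens.grothendieckTopology Y) (Opens.grothendieckTopology X))).symm

end Ab

end Literature.Topology
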